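import Mathlib
import HarnessLib
import HarnessLib.Audit
import Summits.NavierStokesRegularity.Statement
import Summits.NavierStokesRegularity.NavierStokesRegularity.Theses.TaoLadderRungTwoBreak
import Literature.Analysis.FluidPDE.Tao2016AveragedNS.ViscousEnvelopeSmoothing
import Literature.Analysis.FluidPDE.Tao2016AveragedNS.ViscousDyadicMemberRegularity
import Summits.NavierStokesRegularity.NavierStokesRegularity.Theorems.OrthantWakeForwardSourceSmoothing
import HarnessLib.Audit.Status.Attr

/-!
Route: SubOnsagerCeiling

# Route SubOnsagerCeiling — base-uniform sub-Onsager weighted ceiling on the FORWARD-SOURCE tails of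
positive KP networks ⇒ KP conjunct of rung TL-M2Break at every scale ratio (rev 3: KP networks
proper = orthant ∧ diagonal feed forms; second declared residual = non-diagonal orthant pocket)

RUNG-LEAF LINE (D-0145 ideator line g4-1 of seat ns-idea-1, technique card «monotone quantity hunt»;
bears_on TL-M2Break; MODEL
LATTICE ODEs ONLY — nothing here is a statement about Navier–Stokes or Clay (A)–(D); no summit is
proved by a line).
It suffices to show X = X_ceil ∧ X_cone ∧ X_glue together with the DECLARED RESIDUALS X_res
(non-orthant tables, stmt-24640) and X_res2 (non-diagonal orthant pocket, stmt-27000), both shared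
verbatim with route OrthantWake. REV 1 (g5, 2026-08-28): `OrthantTailCeiling` (stmt-25507) is
REFUTED-MISSTATED IN NUMERICS — lead ns-soc-p2's witness α_SB ∈ E₂(10) ∩ orthant = {F 0→0 (1), P 0→1
(1/5), F 1→2 (1/5) into a DEAD-END pocket}: Θ(n) = −ln(sup_t T_n/E₀)/(n ln b) → 5/9 < 1 on bands n ≤
n_ν → ∞ (REFUTATION-EVIDENCE.md; critic re-rule 07:11:26Z; reproduced by the independent cross-check
kit j302483: min W 0.769 at κ = 5.0, Θ < 1 up to n ≈ 46 at (1/4, 10⁻⁸), digits matching) — it stays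
in the file as that settled negative (aside). Its restatement C′₄ = `ForwardTailCeiling`
(stmt-26608) keeps θ > 1/2, C before ν, the face condition, ε₀ ≤ 1 and ALL orthant tables, and
bounds the FORWARD-SOURCE partial tails Σ_(k=n..N) Σ_(i∈S) ½X², S ⊇ S⁺(α) = {i : ∃ j l, α i j l
(0,0,1) ≠ 0}: dead-end pockets are not forward sources (only μ = (0,0,1) terms move energy up; rotor
identity (4.2)–(4.3)), pockets with an exit saturate at Kolmogorov level. MEASURED (j302483,
validated to 3 digits against both sibling instruments): Θ⁺ ≥ 1.19 and W⁺ = 1.571 flat on κ ∈ [1.5,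
18] for T₁₀ at (1/4, 10⁻⁸) AND (1/4, 10⁻¹⁰) (ν-stable) where Θ = 0.45–0.50; Θ⁺ ≥ 1.29, W⁺ = 1.664
for α_SB; W⁺ plateau 1.257 (1/8), 1.303 (1/16) on T₁₀; the park-and-RELEASE rows T₁₀ + P(2→0)(1,
1/10), T₁₀ + P(2→1)(1, 1/10), α_SB + P(2→0)(1/5) and the weak-exit capacitors c ∈ {0.1, 0.02} are
clean for T and T⁺ alike (min Θ ≥ 1.15, W → 1.57–1.66). Glue now via `ForwardSourceSmoothing`
(stmt-26374, shared with SubcriticalEnvelope and OrthantWake) and `ForwardBreakOfCeiling`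
(stmt-26609); `BreakOfCeiling` (25509, proved for T) leaves the cone.
X_ceil (`ForwardTailCeiling`, the deciding crux): for every comparable ORTHANT table α ∈ E₂(R) (KP
network:
quasi-positive nonlinearity on the cone X ≥ 0 above the datum shell) and EVERY scale ratio 1+ε₀ ∈
(1,2], there are θ > 1/2 and C ≥ 0,
depending on (α, ε₀) only, such that every honest viscous solution from a one-shell datum that stays
in the cone obeys the SUB-ONSAGER
WEIGHTED TAIL CEILING  sup_t sup_n (1+ε₀)^(2θn) · Σ_(k ≥ n) e⁺_k(t) ≤ C·E₀  for EVERY viscosity ν >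
0 (e⁺_k = shell energy of the modes in S ⊇ S⁺(α), E₀ = datum
energy). X_cone (`OrthantInvariance`, proved in tree) puts solutions in the cone; X_smooth ∧ X_glue
(`ForwardSourceSmoothing`, `ForwardBreakOfCeiling`) turn a θ > 1/2 forward-source ceiling into
global viscous solutions (slaving of non-source modes + the tree's smoothing bootstrap) at every ε₀
≤ 1 (so the orthant conjunct holds with ε_R = 1).
REV 3 (g5-6, 2026-08-28 ≈09Z): the rev-1/2 crux ForwardTailCeiling (stmt-26608) is DEAD AS TYPED by
the TWIN-EMBEDDING witness of idea-crit-3 / ns-ow-p1 g4 (exact algebra, HOME INBOX ≈08:25Z): split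
the pocket feed of α_SB into twins x_1² → x_2′ (3/25), x_1² → x_3′ (4/25) and add the differential
feed (4x_2 − 3x_3)²/16 → x_0′ (cross coefficient −3/4 < 0; still orthant; E₂(17)); X̃ = (X_0, X_1,
(3/5)X_2, (4/5)X_2) embeds every α_SB solution with the differential feed identically zero; every
mode is a syntactic forward source, S = univ is forced, T⁺ ≡ T_total(α_SB) and Θ → 5/9 < 1 on the
ν-growing band: 26608 inherits 25507's refutation verbatim on NON-DIAGONAL feed forms and stays in
the file as that settled negative (aside, never reworded). REPAIR C′₅ = ForwardTailCeilingKP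
(stmt-27057): the same ceiling (θ > 1/2, C before ν, forward-source observable) on KP NETWORKS
PROPER = orthant tables with DIAGONAL forward feed forms («∀ a b i, a ≠ b → α a b i (0,0,1) = 0»;
every syntactic source self-drains through α_(aai)Λx_a²; all 87 + 61 instrument rows of record lie
in this class, Θ⁺ ≥ 1.02 beyond κ 2); glue KPBreakOfCeiling (stmt-27058; proof plan = the landed
subOnsagerCeiling_breakOfCeiling_proof with T⁺ and the passed-through diagonal hypothesis, feeding
ForwardSourceSmoothing stmt-26374, PROVED 07:51Z); the complement of the KP class inside the orthant
class is the second DECLARED RESIDUAL NonDiagonalOrthantBreak (stmt-27000, shared with OrthantWake;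
thin pocket; recorded plan, not claimed: feed forms of orthant tables are copositive symmetric
Z-matrices hence PSD, zero forward flux ⇔ common kernel N(α), so the basis-free source space V⁺ =
N(α)^⊥ plus rotation covariance of the lattice is the attack). ForwardBreakOfCeiling (stmt-26609)
leaves the cone with its hypothesis (aside).

Lean: `ForwardTailCeilingKP → OrthantInvariance → ForwardSourceSmoothing → KPBreakOfCeiling →
NonDiagonalOrthantBreak → NonOrthantBreak →
Summit.NavierStokesRegularity.NavierStokesRegularity.Theses.TaoLadderRungTwoBreak.Target`

## Assembly
Pure logic, PROVED in glue.lean (`closes`, kernel-checked with Sketch8: rc 0, 0 sorries): fix R ≥ 1;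
NonDiagonalOrthantBreak gives ε₃, NonOrthantBreak gives ε₂; take εR = min 1 (min ε₃ ε₂); for ε₀ ≤ εR
split `by_cases` on the orthant sign predicate of α and, inside, on the diagonal-feed predicate: KP
tables → KPBreakOfCeiling fed with ForwardTailCeilingKP, OrthantInvariance, ForwardSourceSmoothing
(valid for every ε₀ ≤ 1); non-diagonal orthant → residual #2; non-orthant → residual #1. CONJUNCT
SPLIT (declared): attacked = KP conjunct; residuals = NonOrthantBreak (stmt-24640) and
NonDiagonalOrthantBreak (stmt-27000).

CLOSES_TARGET: closes rung TL-M2Break of NavierStokesRegularity: Summit.NavierStokesRegularity.NavierStokesRegularity.Theses.TaoLadderRungTwoBreak.Target (D-0061; not the summit Statement) — the deciding theorem of this route concludes that registered leaf instead of the Statement decl `NavierStokesRegularity` (class rung: servable and labelled, never counted as concluding the summit Statement).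

Rationale: WHY THIS LINE. The monotone quantity is a WEIGHTED SUPREMUM, not a sum: in the hydrodynamic limit κ
= n·log(1+ε₀) the positive KP lattice becomes the
scalar cascade law E_τ + ∂_κ(e^(5κ/2)(2E)^(3/2)) = 0, for which V_θ(τ) = sup_κ e^(2θκ)E is
NON-INCREASING for every θ < 5/6 with the
explicit margin E_τ = −(5−6θ)·e^(5κ/2)(2E)^(1/2)E at a weighted maximum
(bc/OrthantTailCeiling_rung.lean, no sorry) — an exact maximum
principle whose lattice shadow is an invariant SUBLEVEL SET of 𝒯_θ = sup_n b^(2θn)T_n with a bounded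
loss C per table. Known boxes lose
a constant PER SHELL and are therefore pinned to base 2: Barbato–Morandin arXiv:1201.2693 (Thm
p.4/p.8: sup_n k_n^(1/3−1/(3β))X_n ≤
Ct^(−1/3), i.e. θ = (5/6)(1−1/β) < 1/2 for every base b < 2), Cheskidov–Zaya arXiv:1310.7612 Thm
4.1/4.2 (θ = 3/5 at λ_j = 2^j, steps
certified numerically), Barbato–Morandin–Romito arXiv:1007.3401 (λ = 2; the tree's
`invariantRegion_le_one` needs L ≥ 3.972); removing
"λ = 2" is asked for in print (arXiv:1506.07480 p.3, arXiv:2209.10203 §3.2, Tao arXiv:1402.0290 §1.2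
on the λ-sensitivity). Imported
areas: discrete/numerical maximum principles for diffusive semi-discretisations of scalar
conservation laws (the lattice's modified
equation is Ė = cX̄(−3E_κ + ½E_κκ): net numerical viscosity, entropy fronts, not Toda solitons) and
computer-assisted invariant
polytopes (interval arithmetic on a grid of bases, continuity in b). Versus the listed routes:
OrthantWake's `OrthantHopWake` is a
PER-HOP transient ratchet at small ε₀ ≤ ε̄(R) with class-uniform constants; SubcriticalEnvelope's
`SubcriticalTailEnvelope` is the
window-wise envelope for ALL tables and pseudo-solutions with no mechanism; TransitMassLedger /
WakeRatchet / LoopPeriodRatchet count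
transit mass or periods. None uses a global weighted-sup invariant set, none covers ε₀ up to 1, none
has a continuum comparison theorem.

RANKED CRUXES. #2 ForwardTailCeilingKP (crux, stmt-27057, C′₅, NEW rev 3) — ∀ R ≥ 1 ∀ ε₀ ∈ (0,1] ∀ α
∈ E₂(R) orthant with DIAGONAL forward feed forms ∃ S ⊇ S⁺(α) ∃ θ > 1/2 ∃ C ≥ 0 ∀ ν > 0 ∀ X₀ ∀ s ∀
regular non-negative ν-viscous solution X on [0,s]: ∀ n ≤ N ∀ t ≤ s, Σ_(k=n..N) Σ_(i∈S) ½X_(i,k)(t)²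
≤ C·E₀·(1+ε₀)^(−2θn). [difficulty: XL] (why it might fail: a KP network with a ν-uniformly critical
forward-source tail — capacitor re-entry at rate ∝ ν-independent but ε₀-small, or the dumbbell
exponent W(ε₀) → 1 as ε₀ → 0 (1.257 at 1/8, 1.30 at 1/16; 1/64 pending kit j303108) forcing θ ≤ 1/2
at small ε₀.) [REFUTATION-EVIDENCE stmt-25507, CENSUS-24639-v3, kit:j302483, kit:j302646,
kit:j303295, BarbatoMorandinRomito2011, Cheskidov2008, arXiv:1402.0290, Tao2016AveragedNS]. BC7
CLEAN (P1/P2/P2h/P3/P5 ok); BC2 both directions fail (folder repair7/bc). Registered skeleton of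
26608 (FwdShellBarrier: stub_fwdCeilingLargeRatio / stub_fwdCeilingSmallRatio) transfers verbatim
with the diagonal hypothesis added to both stubs (to be re-registered on 27057 by a seat allowed to
crux-write). STATE OF RECORD (rev 5, 2026-08-28; KEY-NS #124/#133 (a)/#138, DIRECTOR-NS #204 (6)):
THIS IS THE CLUSTER'S ONE STRUCTURAL PLAN. Skeleton of record «kp-shell-barrier» v2 (LEAD ns-soc-p2;
tree Cruxes/ForwardTailCeilingKP/Lines/kp_shell_barrier.lean, sha16 b7726a85046a7795, critic kernel
stamp 11:07Z): stubs `stub_kpCeilingLargeRatio` (1/4 < ε₀ ≤ 1) / `stub_kpCeilingSmallRatio` (ε₀ ≤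
1/4), signatures unchanged from v1, BOTH ≥ open-in-print (KEY-NS #124 (B) price of record:
restricted to α = c·dyadicTable each contains the λ-uniform BMR/CZ θ > 1/2 ceiling for the
Katz–Pavlović chain on its ratio range, in print at b = 2 only) — a price, not a strike;
`rung_dyadicRange` PROVED inside the skeleton from the landed `dyadicRange_shellBarrierAt : ∀ R, ∀
ε₀ ∈ [7/10,1], ∀ α, IsScaledDyadic α → ShellBarrierAt R ε₀ α` (p625959; with p624603 region
inequalities, p624803 first-exit on the infinite chain, p625516 chain wrapper): the ν-uniform θ =
101/200 shell barrier / forward tail ceiling for the positive viscous KP chain at EVERY b ∈ [1.7, 2]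
— the first kernel θ > 1/2 ceiling at any ratio other than λ = 2, 0 kit; corollaries p626568
`dyadicRange_viscousGlobal` / `dyadicRange_not_noGlobalCascade` (the KP conjunct of the rung target
on the one-mode chain class for b ∈ [1.7, 2]; = aside 24644's clause on [7/10, 1]). KEY-NS #138: (1)
the open model-lattice frontier «b < 1.7 via ≥ 3-window certified regions + the general-KP
energy/time-integral ingredient (pockets are unbounded in rescaled sup variables)» is ONE
certificate factory = LEAD SOC ALONE (generic d-window first-exit lemma first); (2) OrthantWake's
socket/transport pipeline consumes these regions by name, no second factory; (3) SubcriticalEnvelope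
takes no structural hour on 27130 until the W5 word, then its LEAD lends one pair of hands to a
named piece of this skeleton; (4) kernel facts of record: 24644 proved on [7/10, 1] by p626568 and
on [13/20, 1] by ow-p1's 2-mode sub-interval certificates (p629445, p630847, p631429; method floor b
≈ 1.62), open below 13/20; 2-window regions die near b ≈ 1.58–1.62 (census v3 + ow-p1 memo agree).
BINDER VET of record (refuter1 g12, DIRECTOR-NS #212 (2), 2026-08-28 11:41Z, K-118):
ForwardTailCeilingKP PASS-AS-TYPED — no vacuity (zero table honest), no junk value, quantifiers ∃S
∃θ ∃C before ν/X₀/s/X/n/N/t with E₀-linearity consistent with the lattice scaling; load-bearing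
hypotheses = DIAGONAL / ORTHANT / S-restriction by the route's own witnesses; strength
«numerics-thin» (booked margins min Θ⁺ ≈ 1.008–1.02 beyond κ = 2), typing clean. W5 FINAL: PENDING
at this writing (2026-08-28 ≈11:50Z) — run of record kit j304565 at 43/58 rows with every FINAL
column CLEAR-compatible (12-block ≥ 1.257 everywhere; Θ^S(κ>2) ≥ 1.159 on α_SB^leak; T₁₀^leak = its
leak-free control at the chain head, a transient; ε₀ = 1/16 N+20 % column kit j304977 FINAL: Θ^S
1.616–1.646, 12-block 1.659–1.661), three ε₀ = 1/16 N_rec rows wall-cut before t = 30 (excluded by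
the pre-stated criterion, not by value) and re-running as kit j306164 / j307577 / j307578, memo ETA
≈12:30Z (ns-idea-1 g5 11:43Z); the critic's FINAL word («W5 CLEAR (run of record agrees)» unfreezes
27057's structural hours per KEY-NS #133 (a) / DIRECTOR-NS #204 (6); DISAGREE keeps the freeze) is
recorded on the items as evidence, not in this header.
#3 NonOrthantBreak (crux, stmt-24640) — RESIDUAL CONJUNCT #1 (declared, unchanged): non-orthant
tables. [difficulty: XL]
#3 NonDiagonalOrthantBreak (crux, stmt-27000, shared with OrthantWake) — RESIDUAL CONJUNCT #2
(declared): orthant tables with a non-diagonal forward feed form (the twin-embedding pocket); not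
attacked; recorded plan = basis-free source space V⁺(α) = (⋂_i ker A_i)^⊥ + rotation covariance.
[difficulty: L–XL] (why it might fail: feed forms not simultaneously diagonalisable and
kernel-direction energy recycled into sources at a ν-dependent rate; or small-ε₀ global existence
fails there.) [HOME INBOX idea-crit-3 2026-08-28; REFUTATION-EVIDENCE stmt-25507].
#3 ForwardSourceSmoothing (crux, stmt-26374, shared) — PROVED 2026-08-28T07:51Z
(`forwardSourceSmoothing_proof`).
#4 KPBreakOfCeiling (crux = glue with content, stmt-27058, NEW rev 3; PROVED — CLOSED
2026-08-28T10:03:44Z by `subOnsagerCeiling_kpBreakOfCeiling_proof`, p623345, ns-soc-p2 g3) —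
ForwardTailCeilingKP → OrthantInvariance → ForwardSourceSmoothing → KP conjunct for every ε₀ ≤ 1;
proof = the landed subOnsagerCeiling_breakOfCeiling_proof with T⁺ for T (ceiling θ > 1/2 ⇒
window-wise subcritical envelope with η = 2θ − 1 and constant C·E₀ ⇒ smoothing at each κ ⇒ hasGlobal
⇒ ¬NoGlobalCascade). [difficulty: M] (why it might fail: low formal risk — partial sums vs the
envelope's Finset.Icc form, E₀ from the datum, the passed-through diagonal hypothesis.)
[tree:Theorems/SubOnsagerCeilingBreakOfCeiling.lean,
tree:Theorems/SubcriticalEnvelopeForwardSourceSmoothingFar.lean]. BC7 CLEAN [P3 timeout].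
#9 OrthantInvariance (support, stmt-25508, PROVED). ASIDES (settled, never reworded):
OrthantTailCeiling (stmt-25507, total-tail ceiling: α_SB), ForwardTailCeiling (stmt-26608,
syntactic-S⁺ ceiling: twin embedding on non-diagonal tables), ForwardBreakOfCeiling (stmt-26609),
BreakOfCeiling (stmt-25509, proved rev-0 glue), stmt-25511; Assembly (stmt-25510, proved).

KILL CRITERIA. C′₅: a KP network family (orthant, diagonal feeds, fixed spread R) on which the
forward-source tail exponent Θ⁺(n) stays ≤ 1 on a band of shells growing without bound as ν ↓, at
some ε₀ ∈ (0,1], refutes ForwardTailCeilingKP (close --reason refuted:ForwardTailCeilingKP); first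
tests on record: kit j303108 (ε₀ = 1/64: dumbbell at two ν, T₁₀, α_SB, capacitor, N = 1460). FIRED
AND RECORDED, not re-litigated: the total-tail ceiling 25507 (α_SB, Θ → 5/9) and the syntactic-S⁺
ceiling 26608 on non-diagonal tables (twin embedding). A kernel proof that some non-diagonal orthant
table in E₂(R) blows up at arbitrarily small ε₀ refutes NonDiagonalOrthantBreak and with it the rung
target itself. If OrthantWake's block ratchet closes first on the KP class this route is superseded
(its ceiling is implied).

NOT DECOMPOSED YET. The regime threshold (1/4), the polytope shapes per base, the window length ≍
1/ε₀ of the first-crossing argument, the treatment of the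
signed datum shell (energy budget E₀ only) and the dependence C(α, ε₀) (NOT claimed uniform in ε₀ —
uniformity is false as ε₀ → 0 for
fixed θ and irrelevant for the glue, which fixes ε₀ first) are layer-2 matters. REV 3 ADDITION: the
basis-free source space V⁺(α) (projection form of T⁺) and the rotation-covariance lemma of the
lattice that would dissolve NonDiagonalOrthantBreak into the KP case — not filed (needs a projected
ForwardSourceSmoothing).

CHEAPEST FALSIFIER. ONE batched kit job with kp_lattice.py (validated to 3 digits against lattice.c;
Θ⁺ column, lid-safe band via num/analyze_blocks.py): the dumbbell D and T₁₀ at ε₀ ∈ {1/32, 1/64,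
1/128} × ν ∈ {1e-8, 1e-10}, N doubled once, plus the capacitor c = 1/R: kill = Θ⁺(n) ≤ 1 on a band
beyond κ 2 growing as ν ↓ (equivalently the block exponent W⁺ → ≤ 1 as ε₀ → 0). ROWS ON RECORD: kit
j302483/j302646 (38 rows, Θ⁺ ≥ 1 beyond κ 2, W⁺ plateaux 1.257–1.687), kit j303295 (49 cascading
random KP networks, min Θ⁺ 1.038 beyond κ 2), kit j303489/j303958 (asymmetric cycles, Θ⁺ ≥ 1.16),
kit j303108 (ε₀ = 1/64, running at filing).

NUMBERS. θ must exceed 1/2 (envelope-smoothing threshold η = 2θ−1 > 0, tree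
`exists_viscousGlobal_of_subcriticalEnvelope_of_inTableClass`);
continuum ceiling holds up to θ = 5/6 (Onsager/K41 exponent of the cascade law; margin 5−6θ). Known
lattice exponents: BM13 θ(b) =
(5/6)(1−1/β), β = (5/2)log₂b — equals 1/2 at b = 2, < 1/2 below (arXiv:1201.2693 p.4, p.8); CZ16 θ =
3/5 at b = 2 with B(δ) > 0.447
numerically (arXiv:1310.7612 pp.7–9); BMR11 region at b = 2 needs L ≥ 3.972, c ≤ 0.511 (tree
Literature.Barriers…DyadicInvariantRegion
`invariantRegion_le_one`); CORRECTION OF RECORD (rev 5): «needs L ≥ 3.972 … cannot follow b → 1»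
concerned BMR's CONSTANTS only — re-tuning the slope (m = 1/2) makes the same 2-window region
invariant whenever p = b^(5/2−3θ) ≥ 42/25 and L = b^(5/2−θ) ≥ p² (θ = 0.505), i.e. for every b ≥ 1.7
(p625959); 2-window regions provably run out near b ≈ 1.58–1.62 (slant and bottom constraints bind
together; census v3, ow-p1 memo K·D ≳ 3); below that ≥ 3-window regions are required (design task of
the ONE factory, #138 (1)); measured fronts W/2 = θ_X ∈ [0.616, 0.83] (g3 F2).

DEFINITION REQUESTS. None: every constant exists
(`Literature.Analysis.FluidPDE.TaoCascade.InTableClass`, `.NoGlobalCascade`, `.quadTerm`,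
`.dyadicTable`,
rung decl `…Theses.TaoLadderRungTwoBreak.Target`; lean search --decl confirmed, Sketch.lean rc 0).

Novelty: Searches (2026-08-28): lit search --hybrid "dyadic model regularity Kolmogorov bound general lambda
invariant region positive solutions" (8; only arXiv:1506.07480 pp.19–20 on topic); lit vsearch
"<weighted sup bound sup_n λ^(θn)a_n ≤ C for arbitrary λ, positive dyadic solutions>" (8, none on
topic: Frisch 1995 p.130, Temam 1976); lit search "Cheskidov Zaya regularizing dyadic intermittency"
+ lit read arxiv:1310.7612 pp.3,7–9 (λ_j = 2^j fixed; Thm 4.1/4.2 numerics); lit read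
arxiv:1201.2693 pp.4,8 (k_n = 2^(βn), exponent 1/3−1/(3β)); lit read arxiv:1506.07480 p.3 (open:
remove λ = 2 and positivity); lit read arxiv:2209.10203 pp.9–12 (survey: BM/CZ/BMR all at base 2);
lit read arxiv:1207.2846 (tree dyadic model: Thm 2.1–2.3, no transient box); lit galaxy search
"dyadic model|Katz-Pavlovic model|Desnyansky-Novikov" --star pdf (10, all off-topic homonyms) and
earlier g3/g4 galaxy runs "dyadic shell model|shell model of turbulence" (held: Biferale review,
Ditlevsen book — GOY/Sabra phases, no positive-cone ceilings); lean search 'invariantRegion' /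
'scale_bound' (tree: BMR λ = 2 only).
Nearest prior art found: arXiv:1201.2693 (Barbato–Morandin 2013: Kolmogorov-type weighted sup bound
for positive inviscid dyadic, any β, exponent (5/6)(1−1/β) — sub-threshold for every base < 2);
arXiv:1310.7612 (Cheskidov–Zaya: θ = 3/5 regularising box at λ = 2, numerically certified steps);
arXiv:1007.3401 (BMR: invariant region at λ = 2); in-tree route OrthantWake item OrthantHopWake
(per-hop ra  [refs: 1506.07480, 1310.7612, 1201.2693, 2209.10203, 1207.2846, 1007.3401, arxiv:1310.7612, arxiv:1201.2693, arxiv:1506.07480, arxiv:2209.10203, arxiv:1207.2846]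

Barriers (technique_class: invariant-region, weighted-sup, hydro-limit, polytope): - technique_class: invariant-region, weighted-sup, hydro-limit, polytope
- Literature.Barriers.NavierStokesRegularity.DyadicCascadeRegularity: consistent, and the point of
departure — the catalogued fact is BMR regularity of the positive dyadic member AT λ = 2
(`BarbatoMorandinRomito2011_thm1`, `invariantRegion_le_one` in DyadicInvariantRegion.lean needs L ≥
3.972, c ≤ 0.511: base 2, one mode, nearest-neighbour 2-D region; a 2-D nearest-neighbour polygon
provably cannot follow b → 1 since L = b^(2−ε) → 1) together with Tao's remark that the cascade is
λ-sensitive; the crux is exactly the λ-uniform, multi-mode extension the file names as missing.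
Evasion of the scope limit: the ceiling is a functional of the whole weighted TAIL profile with a
loss per table not per shell, its small-ratio half is a comparison with the continuum maximum
principle (not a polygon), and its large-ratio half reuses the tree's scaling bookkeeping
(DyadicInvariantRegionScaling / DyadicCascadeRegionBound, K/δ = 10K) per base [corpus:
Literature/Barriers/NavierStokesRegularity/DyadicCascadeRegularity.lean +
DyadicInvariantRegion.lean; arXiv:1007.3401; arXiv:1506.07480 p.3].
- Literature.Barriers.NavierStokesRegularity.TruncatedDyadicBlowup: does not bite — Tao's Prop 5.1
truncated dyadic blow-up uses an exogenously truncated, time-dependent nonlinearity; the crux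
quantifies over AUTONOMOUS honest solutions of a fixed orthant table on the full lattice with
viscosity, and uses autonomy (cone invariance fo

sub-problem: NavierStokesRegularity · status: open · opened planner-ns-idea-1-g4-0 2026-08-28T03:49:32Z · rev 5 · ledger route-NavierStokesRegularity-SubOnsagerCeiling
GENERATED by the gate from the ledger (D-0016/17). Provers cite these decls: `theorem foo : Summit.NavierStokesRegularity.NavierStokesRegularity.Theses.SubOnsagerCeiling.<Decl> := …` in Summits/NavierStokesRegularity/NavierStokesRegularity/Theorems/<Name>.lean.
-/

namespace Summit.NavierStokesRegularity.NavierStokesRegularity.Theses.SubOnsagerCeiling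

open scoped BigOperators Topology Manifold Classical MeasureTheory ProbabilityTheory Matrix InnerProductSpace ComplexConjugate ContinuousMap
open Filter Set Function TopologicalSpace MeasureTheory

attribute [summit_statement] _root_.NavierStokesRegularity
attribute [summit_statement] _root_.Summit.NavierStokesRegularity.NavierStokesRegularity.Theses.TaoLadderRungTwoBreak.Target

open Literature.NS

/-- item stmt-NavierStokesRegularity-27057 · crux · rank 2 · open · by planner
why it might fail: KP network with a ν-uniformly critical forward-source tail: capacitor re-entry at an ε₀-small but ν-independent rate, or the dumbbell exponent W(ε₀) → 1 as ε₀ → 0 (1.257 at 1/8, 1.30 at 1/16; 1/64 pending kit j303108) forcing θ ≤ 1/2 at small ε₀ with C before ν.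
sources: REFUTATION-EVIDENCE stmt-25507, CENSUS-24639-v3, kit:j302483, kit:j302646, kit:j303295, BarbatoMorandinRomito2011
[crux] KP FORWARD-SOURCE TAIL CEILING (C′₅ = C′₄ restricted to KP networks proper — restatement of
ForwardTailCeiling stmt-26608, dead as typed by the TWIN-EMBEDDING witness of idea-crit-3 / ns-ow-p1
g4 (2026-08-28 ≈08:25Z, exact algebra): splitting the pocket feed of α_SB into twins x_1² → x_2′
(3/25), x_1² → x_3′ (4/25) plus the differential feed (4x_2 − 3x_3)²/16 → x_0′ (cross coefficient
−3/4, still orthant, E₂(17)) makes every mode a SYNTACTIC forward source, so S = univ is forced and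
on the embedded α_SB solutions T⁺ ≡ T_total(α_SB), Θ → 5/9 < 1 — 26608 inherits 25507's refutation
verbatim on NON-DIAGONAL feed forms and stays in the file as that settled negative, never reworded;
and of OrthantTailCeiling stmt-25507, which is REFUTED-MISSTATED IN NUMERICS: witness α_SB ∈ E₂(10)
∩ orthant = {F 0→0 (1), P 0→1 (1/5), F 1→2 (1/5) into a DEAD-END pocket}, Θ(n) = −ln(sup_t
T_n/E₀)/(n ln b) → 5/9 < 1 on bands n ≤ n_ν → ∞ (lead ns-soc-p2 REFUTATION-EVIDENCE.md; critic
idea-crit-3 re-rule 2026-08-28T07:11:26Z); 25507 stays in the file as that settled negative, never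
reworded). C′₅ keeps EVERYTHING of 25507/26608 — ε₀ ∈ (0,1], θ > 1/2 and C chosen BEFORE ν, the
forward-source observable -/
@[route_item "route-NavierStokesRegularity-SubOnsagerCeiling", crux (experiment := "instrument: kit jobs cited as sources kit:j302483, kit:j302646, kit:j303295") (source := "ledger wanted_by.sources on stmt-NavierStokesRegularity-27057, 2026-09-01")]
def ForwardTailCeilingKP : Prop :=
  ∀ R : ℝ, 1 ≤ R → ∀ ε₀ : ℝ, 0 < ε₀ → ε₀ ≤ 1 → ∀ α : Fin 4 → Fin 4 → Fin 4 → ℤ × ℤ × ℤ → ℝ, Literature.Analysis.FluidPDE.TaoCascade.InTableClass R α → (∀ (Y : Fin 4 → ℤ → ℝ → ℝ) (τ : ℝ), (∀ (j : Fin 4) (k : ℤ), 1 ≤ k → 0 ≤ Y j k τ) → ∀ δ : ℝ, 0 < δ → ∀ (i : Fin 4) (n : ℤ), 1 ≤ n → Y i n τ = 0 → 0 ≤ Literature.Analysis.FluidPDE.TaoCascade.quadTerm δ α Y i n τ) → (∀ a b i : Fin 4, a ≠ b → α a b i (0, 0, 1) = 0) → ∃ S : Finset (Fin 4), (∀ i,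 i ∉ S → ∀ j l : Fin 4, α i j l (0, 0, 1) = 0) ∧ ∃ θ : ℝ, 1 / 2 < θ ∧ ∃ C : ℝ, 0 ≤ C ∧ ∀ ν : ℝ, 0 < ν → ∀ (X₀ : Fin 4 → ℝ) (s : ℝ), 0 < s → ∀ X : Fin 4 → ℤ → ℝ → ℝ, (∀ (i : Fin 4) (k : ℤ), X i k 0 = if k = 0 then X₀ i else 0) → (∀ (i : Fin 4) (k : ℤ), k < 0 → ∀ t : ℝ, X i k t = 0) → (∃ M : ℝ, ∀ (t : ℝ) (i : Fin 4) (k : ℤ), (1 + (1 + ε₀) ^ ((10 : ℝ) * k)) * |X i k t| ≤ M) → (∀ (i : Fin 4) (k : ℤ), Continuous (X i k)) → (∀ (i : Fin 4) (k : ℤ), ∀ t ∈ Set.Icc (0 : ℝ) s, HasDerivWithinAt (X i k) (Literature.Analysis.FluidPDE.TaoCascade.quadTerm ε₀ α X i k t - ν * (1 + ε₀) ^ ((2 : ℝ) * k) * X i k t) (Set.Icc (0 : ℝ) s) t) → (∀ t ∈ Set.Icc (0 : ℝ) s, ∀ (i : Fin 4) (k : ℤ), 1 ≤ k → 0 ≤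 X i k t) → ∀ n N : ℕ, n ≤ N → ∀ t ∈ Set.Icc (0 : ℝ) s, ∑ k ∈ Finset.Icc n N, ∑ i ∈ S, (1 / 2 : ℝ) * X i (k : ℤ) t ^ 2 ≤ C * (∑ i : Fin 4, (1 / 2 : ℝ) * X₀ i ^ 2) * (1 + ε₀) ^ (-(2 * θ * (n : ℝ)))

/-- item stmt-NavierStokesRegularity-24640 · crux · rank 3 · open · by planner
why it might fail: it is the rung target on the generic sign-mixing (gated) tables — Tao-type circuits with spread R(ε₀) → ∞ do blow up, and a fixed-spread gated table efficient as ε₀ → 0 would refute it; nothing in this line applies off the cone.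
sources: arXiv:1402.0290, arXiv:2501.07377
[crux] RESIDUAL CONJUNCT (declared): for every R ≥ 1 there is εR > 0 such that for ε₀ ≤ εR every
NON-orthant table α ∈ E₂(R) and every one-shell datum admit global pseudo-solutions
(¬NoGlobalCascade ε₀ α X₀). Not attacked by this line (it is the complement of the orthant conjunct;
the lines WakeRatchet / SubcriticalEnvelope / LatticeTransitLiouville / TransitMassLedger bear on
it). [difficulty: XL] -/
@[route_item "route-NavierStokesRegularity-SubOnsagerCeiling", crux]
def NonOrthantBreak : Prop :=
  ∀ R : ℝ, 1 ≤ R → ∃ εR : ℝ, 0 < εR ∧ ∀ ε₀ : ℝ, 0 < ε₀ → ε₀ ≤ εR → ∀ (α : Fin 4 → Fin 4 → Fin 4 → ℤ × ℤ × ℤ → ℝ) (X₀ : Fin 4 → ℝ), Literature.Analysis.FluidPDE.TaoCascade.InTableClass R α → ¬ (∀ (Y : Fin 4 → ℤ → ℝ → ℝ) (τ : ℝ), (∀ (j : Fin 4) (k : ℤ), 1 ≤ k → 0 ≤ Y j k τ) → ∀ δ : ℝ, 0 < δ → ∀ (i : Fin 4) (n : ℤ), 1 ≤ n → Y i n τ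 = 0 → 0 ≤ Literature.Analysis.FluidPDE.TaoCascade.quadTerm δ α Y i n τ) → ¬ Literature.Analysis.FluidPDE.TaoCascade.NoGlobalCascade ε₀ α X₀

/-- item stmt-NavierStokesRegularity-26374 · crux · rank 3 · closed · proved by Summit.NavierStokesRegularity.NavierStokesRegularity.Theorems.forwardSourceSmoothing_proof (prover) · by planner
why it might fail: Slaving of non-source modes needs every power term into them to carry a source amplitude or a source pair below (rotor identity, (4.2)–(4.3), Tao's shift set) plus ⌈1/η⌉ catalyst passes lifting their decay exponent above 1/2; a missed coupling type or a non-summable energy identity breaks it.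
sources: Tao2016AveragedNS, BarbatoMorandinRomito2011, Literature:exists_viscousGlobal_of_subcriticalEnvelope_of_inTableClass, Literature:viscous_bootstrap_step
[crux] FORWARD-SOURCE ENVELOPE SMOOTHING (fixed ν, constants free; rank 3 — a real extension of the
landed engine, not a citation). If S contains every forward source of α ∈ E₂(R) (i ∉ S ⇒ α i j l
(0,0,1) = 0) and on every window [0,T] the S-mode partial tail energies of all regular ν-viscous
solutions on sub-windows [0,s] obey a subcritical envelope C(T)(1+ε₀)^{−(1+η)n}, then a GLOBAL
regular solution of the ν-viscous lattice exists (`ViscousGlobal ε₀ ν α X₀ X`). The landed engine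
`exists_viscousGlobal_of_subcriticalEnvelope` (p593260; bootstrap `viscous_bootstrap_step` γ ↦ 2γ −
1/2 from any γ > 1/2, continuation `exists_viscousGlobal_of_apriori_bound`) needs the envelope on
ALL modes; the new step is the SLAVING of the non-source modes D = Sᶜ: per shell k ≥ 1 they start
empty, receive (0,0,1)-injection only from PAIRS of sources at shell k−1 (α a b d (0,0,1) ≠ 0 forces
a, b ∈ S by (4.2)), exchange energy with same-shell sources only through terms carrying a source
amplitude (in-shell triads) or through rotors catalysed by a shell-(k+1) amplitude whose partner is
a source (two-shell triads with vanishing (0,0,1) coefficient are rotors inside the lower shell by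
(4.2)–(4.3)), and ar -/
@[route_item "route-NavierStokesRegularity-SubOnsagerCeiling", crux]
def ForwardSourceSmoothing : Prop :=
  ∀ (ε₀ η R : ℝ), 0 < ε₀ → 0 < η → ∀ α : Fin 4 → Fin 4 → Fin 4 → ℤ × ℤ × ℤ → ℝ, Literature.Analysis.FluidPDE.TaoCascade.InTableClass R α → ∀ S : Finset (Fin 4), (∀ i, i ∉ S → ∀ j l : Fin 4, α i j l (0, 0, 1) = 0) → ∀ (X₀ : Fin 4 → ℝ) (ν : ℝ), 0 < ν → (∀ T : ℝ, 0 < T → ∃ C : ℝ, ∀ s ∈ Set.Ioc (0 : ℝ) T, ∀ X : Fin 4 → ℤ → ℝ → ℝ, (∀ i k, X i k 0 = if k = 0 then X₀ i else 0) → (∀ i k, k < 0 → ∀ t, X i k t = 0) → (∃ M : ℝ, ∀ (t : ℝ) (i : Fin 4) (k : ℤ), (1 + (1 + ε₀) ^ ((10 : ℝ) * k)) * |X i k t| ≤ M) → (∀ i k, Continuous (X i k)) → (∀ i k, ∀ t ∈ Set.Icc (0 : ℝ) s, HasDerivWithinAt (X i k) (Literature.Analysis.FluidPDE.TaoCascade.quadTerm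 ε₀ α X i k t - ν * (1 + ε₀) ^ ((2 : ℝ) * k) * X i k t) (Set.Icc 0 s) t) → ∀ n N : ℕ, n ≤ N → ∀ t ∈ Set.Icc (0 : ℝ) s, ∑ k ∈ Finset.Icc n N, ∑ i ∈ S, (1 / 2) * X i (k : ℤ) t ^ 2 ≤ C * (1 + ε₀) ^ (-((1 + η) * (n : ℝ)))) → ∃ X : Fin 4 → ℤ → ℝ → ℝ, Literature.Analysis.FluidPDE.TaoCascade.ViscousGlobal ε₀ ν α X₀ X

/-- `ForwardSourceSmoothing` holds: proved by `Summit.NavierStokesRegularity.NavierStokesRegularity.Theorems.forwardSourceSmoothing_proof`. -/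
theorem ForwardSourceSmoothing_holds : ForwardSourceSmoothing := _root_.Summit.NavierStokesRegularity.NavierStokesRegularity.Theorems.forwardSourceSmoothing_proof

/-- item stmt-NavierStokesRegularity-27000 · crux · rank 3 · open · by planner
why it might fail: Feed forms not simultaneously diagonalisable: kernel-direction energy recycled into sources at a ν-dependent rate; or small-ε₀ global existence genuinely fails on some non-diagonal orthant table (would refute the rung itself).
sources: HOME INBOX idea-crit-3 2026-08-28T08:25Z twin embedding, REFUTATION-EVIDENCE stmt-25507, Tao2016AveragedNS
[crux] DECLARED RESIDUAL #2 (rank 3; not attacked by this line, exempt like NonOrthantBreak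
stmt-24640): the NON-DIAGONAL ORTHANT POCKET — ∀ R ≥ 1 ∃ εR > 0 ∀ ε₀ ≤ εR ∀ α ∈ E₂(R) orthant whose
forward feed forms are NOT all diagonal (some α a b i (0,0,1) ≠ 0 with a ≠ b) ∀ X₀, ¬NoGlobalCascade
ε₀ α X₀. This is exactly the pocket exhibited by the twin-embedding witness (idea-crit-3 / ns-ow-p1
g4, 2026-08-28): a dead-end pocket table (α_SB, T₁₀) rotated in a mode plane so that the parked
direction is the null direction of a rank-one feed form (4x_2 − 3x_3)²/16; on it every syntactic
forward-source functional equals the total tail energy and inherits the total-tail refutations (Θ →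
5/9, W = 0.20–0.47). Why it is a thin pocket and what would attack it: for ORTHANT tables each
forward feed form A_i (matrix a,b ↦ α a b i (0,0,1)) is a symmetric Z-matrix that is copositive,
hence positive semidefinite, so a shell configuration carries zero forward flux iff it lies in the
common kernel N(α) = ⋂_i ker A_i; the basis-free source space V⁺(α) = N(α)^⊥ (projection P) in place
of the coordinate set S⁺ defeats every rotated-pocket disguise (for the twin table V⁺ = span{e_0,
e_1, 4e_2 − 3e_3} and T^ -/
@[route_item "route-NavierStokesRegularity-SubOnsagerCeiling", crux]
def NonDiagonalOrthantBreak : Prop :=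
  ∀ R : ℝ, 1 ≤ R → ∃ εR : ℝ, 0 < εR ∧ ∀ ε₀ : ℝ, 0 < ε₀ → ε₀ ≤ εR → ∀ (α : Fin 4 → Fin 4 → Fin 4 → ℤ × ℤ × ℤ → ℝ) (X₀ : Fin 4 → ℝ), Literature.Analysis.FluidPDE.TaoCascade.InTableClass R α → (∀ (Y : Fin 4 → ℤ → ℝ → ℝ) (τ : ℝ), (∀ (j : Fin 4) (k : ℤ), 1 ≤ k → 0 ≤ Y j k τ) → ∀ δ : ℝ, 0 < δ → ∀ (i : Fin 4) (n : ℤ), 1 ≤ n → Y i n τ = 0 → 0 ≤ Literature.Analysis.FluidPDE.TaoCascade.quadTerm δ α Y i n τ) → ¬ (∀ a b i : Fin 4, a ≠ b → α a b i (0, 0, 1) = 0) → ¬ Literature.Analysis.FluidPDE.TaoCascade.NoGlobalCascade ε₀ α X₀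

/-- item stmt-NavierStokesRegularity-25507 · aside · rank 2 · open · by planner
why it might fail: a KP network whose front runs with weighted exponent W ≤ 1 at some ε₀ ≤ 1 (a wake-free, Toda-like coherent pulse on the positive cone; in-shell fast loops feeding a slow inter-shell jump) breaks every θ > 1/2; g3 data W ≥ 1.23 on 5 networks only.
sources: arXiv:1201.2693, arXiv:1310.7612, arXiv:1007.3401, arXiv:1506.07480, arXiv:1402.0290, arXiv:1409.4682
[crux] (deciding, NEW) for every R ≥ 1, every ε₀ ∈ (0,1] and every comparable orthant table α ∈
E₂(R) there are θ > 1/2 and C ≥ 0 such that for every ν > 0 every honest viscous lattice solution on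
[0,s] from a one-shell datum X₀ (vanishing below the datum shell, weighted-bounded, continuous,
non-negative on shells ≥ 1) satisfies Σ_(k=n..N) Σ_i ½X_(i,k)(t)² ≤ C·E₀·(1+ε₀)^(−2θn) for all n ≤ N
and t ∈ [0,s]. [difficulty: XL] -/
@[route_item "route-NavierStokesRegularity-SubOnsagerCeiling", crux]
def OrthantTailCeiling : Prop :=
  ∀ R : ℝ, 1 ≤ R → ∀ ε₀ : ℝ, 0 < ε₀ → ε₀ ≤ 1 → ∀ α : Fin 4 → Fin 4 → Fin 4 → ℤ × ℤ × ℤ → ℝ, Literature.Analysis.FluidPDE.TaoCascade.InTableClass R α → (∀ (Y : Fin 4 → ℤ → ℝ → ℝ) (τ : ℝ), (∀ (j : Fin 4) (k : ℤ), 1 ≤ k → 0 ≤ Y j k τ) → ∀ δ : ℝ, 0 < δ → ∀ (i : Fin 4) (n : ℤ), 1 ≤ n → Y i n τ = 0 → 0 ≤ Literature.Analysis.FluidPDE.TaoCascade.quadTerm δ α Y i n τ) → ∃ θ : ℝ, 1 / 2 < θ ∧ ∃ C : ℝ, 0 ≤ C ∧ ∀ ν : ℝ, 0 < ν → ∀ (X₀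 : Fin 4 → ℝ) (s : ℝ), 0 < s → ∀ X : Fin 4 → ℤ → ℝ → ℝ, (∀ (i : Fin 4) (k : ℤ), X i k 0 = if k = 0 then X₀ i else 0) → (∀ (i : Fin 4) (k : ℤ), k < 0 → ∀ t : ℝ, X i k t = 0) → (∃ M : ℝ, ∀ (t : ℝ) (i : Fin 4) (k : ℤ), (1 + (1 + ε₀) ^ ((10 : ℝ) * k)) * |X i k t| ≤ M) → (∀ (i : Fin 4) (k : ℤ), Continuous (X i k)) → (∀ (i : Fin 4) (k : ℤ), ∀ t ∈ Set.Icc (0 : ℝ) s, HasDerivWithinAt (X i k) (Literature.Analysis.FluidPDE.TaoCascade.quadTerm ε₀ α X i k t - ν * (1 + ε₀) ^ ((2 : ℝ) * k) * X i k t) (Set.Icc (0 : ℝ) s) t) → (∀ t ∈ Set.Icc (0 : ℝ) s, ∀ (i : Fin 4) (k : ℤ), 1 ≤ k → 0 ≤ X i k t) → ∀ n N : ℕ, n ≤ N → ∀ t ∈ Set.Icc (0 : ℝ) s, ∑ k ∈ Finset.Icc n N, ∑ i : Fin 4, (1 / 2 : ℝ) * X i (k : ℤ) t ^ 2 ≤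 C * (∑ i : Fin 4, (1 / 2 : ℝ) * X₀ i ^ 2) * (1 + ε₀) ^ (-(2 * θ * (n : ℝ)))

/-- item stmt-NavierStokesRegularity-26608 · aside · rank 2 · open · by planner
why it might fail: A forward SOURCE holding ν-uniformly supercritical standing energy behind the front on an orthant architecture not yet run (slow park-and-release into a source via weak 1/R pump chains), W⁺(ε₀) ≤ 1 at some ε₀ ≤ 1 (plateaux 1.57/1.26/1.30, non-monotone), or BMR-type positivity failing below ratio 2.
sources: REFUTATION-EVIDENCE-25507, kit:j302483, arXiv:1201.2693, arXiv:1310.7612, arXiv:1007.3401, arXiv:1402.0290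
[crux] FORWARD-SOURCE TAIL CEILING (C′₄ — restatement of OrthantTailCeiling stmt-25507, which is
REFUTED-MISSTATED IN NUMERICS: witness α_SB ∈ E₂(10) ∩ orthant = {F 0→0 (1), P 0→1 (1/5), F 1→2
(1/5) into a DEAD-END pocket}, Θ(n) = −ln(sup_t T_n/E₀)/(n ln b) → 5/9 < 1 on bands n ≤ n_ν → ∞
(lead ns-soc-p2 REFUTATION-EVIDENCE.md; critic idea-crit-3 re-rule 2026-08-28T07:11:26Z); 25507
stays in the file as that settled negative, never reworded). C′₄ keeps EVERYTHING of 25507 — all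
orthant tables α ∈ E₂(R), ε₀ ∈ (0,1], θ > 1/2 and C chosen BEFORE ν, X₀, the window and the
solution, honest non-negative ν-viscous solutions, partial sums Σ_{k=n..N} — and changes only the
OBSERVABLE: the bound is on the forward-source partial tails Σ_{k=n..N} Σ_{i∈S} ½X_{i,k}(t)² for
some S ⊇ S⁺(α) = {i : ∃ j l, α i j l (0,0,1) ≠ 0} chosen after α (typed `∃ S : Finset (Fin 4), (∀ i
∉ S, ∀ j l, α i j l (0,0,1) = 0) ∧ ∃ θ …`). WHY THIS MISSES THE WITNESS: only μ = (0,0,1) terms of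
quadTerm move energy up a shell and a two-shell triad with vanishing (0,0,1) coefficient is a rotor
inside the lower shell ((4.2)–(4.3)); a dead-end pocket is by definition not a forward source, so
its parked energy ∝ b^{−5k/9} is n -/
@[route_item "route-NavierStokesRegularity-SubOnsagerCeiling", crux (experiment := "instrument: kit jobs cited as sources kit:j302483") (source := "ledger wanted_by.sources on stmt-NavierStokesRegularity-26608, 2026-09-01")]
def ForwardTailCeiling : Prop :=
  ∀ R : ℝ, 1 ≤ R → ∀ ε₀ : ℝ, 0 < ε₀ → ε₀ ≤ 1 → ∀ α : Fin 4 → Fin 4 → Fin 4 → ℤ × ℤ × ℤ → ℝ, Literature.Analysis.FluidPDE.TaoCascade.InTableClass R α → (∀ (Y : Fin 4 → ℤ → ℝ → ℝ) (τ : ℝ), (∀ (j : Fin 4) (k : ℤ), 1 ≤ k → 0 ≤ Y j k τ) → ∀ δ : ℝ, 0 < δ → ∀ (i : Fin 4) (n : ℤ), 1 ≤ n → Y i n τ = 0 → 0 ≤ Literature.Analysis.FluidPDE.TaoCascade.quadTerm δ α Y i n τ) → ∃ S : Finset (Fin 4), (∀ i, i ∉ S → ∀ j l : Fin 4, α i j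 l (0, 0, 1) = 0) ∧ ∃ θ : ℝ, 1 / 2 < θ ∧ ∃ C : ℝ, 0 ≤ C ∧ ∀ ν : ℝ, 0 < ν → ∀ (X₀ : Fin 4 → ℝ) (s : ℝ), 0 < s → ∀ X : Fin 4 → ℤ → ℝ → ℝ, (∀ (i : Fin 4) (k : ℤ), X i k 0 = if k = 0 then X₀ i else 0) → (∀ (i : Fin 4) (k : ℤ), k < 0 → ∀ t : ℝ, X i k t = 0) → (∃ M : ℝ, ∀ (t : ℝ) (i : Fin 4) (k : ℤ), (1 + (1 + ε₀) ^ ((10 : ℝ) * k)) * |X i k t| ≤ M) → (∀ (i : Fin 4) (k : ℤ), Continuous (X i k)) → (∀ (i : Fin 4) (k : ℤ), ∀ t ∈ Set.Icc (0 : ℝ) s, HasDerivWithinAt (X i k) (Literature.Analysis.FluidPDE.TaoCascade.quadTerm ε₀ α X i k t - ν * (1 + ε₀) ^ ((2 : ℝ) * k) * X i k t) (Set.Icc (0 : ℝ) s) t) → (∀ t ∈ Set.Icc (0 : ℝ) s, ∀ (i : Fin 4) (k : ℤ), 1 ≤ k → 0 ≤ X i k t) → ∀ n N : ℕ, n ≤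 N → ∀ t ∈ Set.Icc (0 : ℝ) s, ∑ k ∈ Finset.Icc n N, ∑ i ∈ S, (1 / 2 : ℝ) * X i (k : ℤ) t ^ 2 ≤ C * (∑ i : Fin 4, (1 / 2 : ℝ) * X₀ i ^ 2) * (1 + ε₀) ^ (-(2 * θ * (n : ℝ)))

/-- item stmt-NavierStokesRegularity-25508 · support · rank 9 · closed · proved by Summit.NavierStokesRegularity.NavierStokesRegularity.Theorems.subOnsagerCeiling_orthantInvariance_proof (prover) · by planner
sources: arXiv:1007.3401, tree:Summit.NavierStokesRegularity.NavierStokesRegularity.Theorems.orthantInvariance_proof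
[support] (shared verbatim with route OrthantWake item OrthantInvariance; PROVED in tree by
`Summit.NavierStokesRegularity.NavierStokesRegularity.Theorems.orthantInvariance_proof`) Kamke
forward invariance of the positive cone above the datum shell for honest viscous solutions of an
orthant table. [difficulty: provable-now] -/
@[route_item "route-NavierStokesRegularity-SubOnsagerCeiling", crux]
def OrthantInvariance : Prop :=
  ∀ ε₀ ν : ℝ, 0 < ε₀ → 0 < ν → ∀ α : Fin 4 → Fin 4 → Fin 4 → ℤ × ℤ × ℤ → ℝ, (∀ (Y : Fin 4 → ℤ → ℝ → ℝ) (τ : ℝ), (∀ (j : Fin 4) (k : ℤ), 1 ≤ k → 0 ≤ Y j k τ) → ∀ δ : ℝ, 0 < δ → ∀ (i : Fin 4) (n : ℤ), 1 ≤ n → Y i n τ = 0 → 0 ≤ Literature.Analysis.FluidPDE.TaoCascade.quadTerm δ α Y i n τ) → ∀ (X₀ : Fin 4 → ℝ) (s : ℝ), 0 < s → ∀ X : Fin 4 → ℤ → ℝ → ℝ, (∀ (i : Fin 4) (k : ℤ), X i k 0 = if k = 0 then X₀ i else 0) → (∀ (i : Fin 4) (k : ℤ), k < 0 → ∀ t :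 ℝ, X i k t = 0) → (∃ M : ℝ, ∀ (t : ℝ) (i : Fin 4) (k : ℤ), (1 + (1 + ε₀) ^ ((10 : ℝ) * k)) * |X i k t| ≤ M) → (∀ (i : Fin 4) (k : ℤ), Continuous (X i k)) → (∀ (i : Fin 4) (k : ℤ), ∀ t ∈ Set.Icc (0 : ℝ) s, HasDerivWithinAt (X i k) (Literature.Analysis.FluidPDE.TaoCascade.quadTerm ε₀ α X i k t - ν * (1 + ε₀) ^ ((2 : ℝ) * k) * X i k t) (Set.Icc (0 : ℝ) s) t) → (∀ t ∈ Set.Icc (0 : ℝ) s, ∀ (i : Fin 4) (k : ℤ), 1 ≤ k → 0 ≤ X i k t)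

-- `OrthantInvariance` holds: proved by `Summit.NavierStokesRegularity.NavierStokesRegularity.Theorems.subOnsagerCeiling_orthantInvariance_proof` (its module imports this route file, so no `_holds` link can be stated here).

/-- item stmt-NavierStokesRegularity-27058 · crux · rank 4 · closed · proved by Summit.NavierStokesRegularity.NavierStokesRegularity.Theorems.subOnsagerCeiling_kpBreakOfCeiling_proof (prover) · by planner
why it might fail: Low formal risk: partial sums vs the envelope's Finset.Icc form, E₀ from the datum hypothesis, the passed-through diagonal-feed hypothesis; the landed subOnsagerCeiling_breakOfCeiling_proof must be re-run with T⁺ for T.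
sources: tree:Theorems/SubOnsagerCeilingBreakOfCeiling.lean, tree:Theorems/SubcriticalEnvelopeForwardSourceSmoothingFar.lean
[crux] GLUE WITH CONTENT (rank 4; replaces ForwardBreakOfCeiling stmt-26609, whose hypothesis
ForwardTailCeiling is dead as typed and which leaves the cone): ForwardTailCeilingKP →
OrthantInvariance → ForwardSourceSmoothing → the KP conjunct of the rung target for every ε₀ ∈
(0,1]: ∀ R ≥ 1 ∀ ε₀ ≤ 1 ∀ orthant diagonal-feed α ∈ E₂(R) ∀ X₀, ¬NoGlobalCascade ε₀ α X₀ (the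
diagonal-feed hypothesis is only passed through to the ceiling). Proof plan = the landed
`subOnsagerCeiling_breakOfCeiling_proof` with T⁺ for T: the ceiling with θ > 1/2 is a window-wise
subcritical envelope of the S-mode partial tails with η = 2θ − 1 > 0 and constant C·E₀ uniform in ν
and in the window; OrthantInvariance supplies the non-negativity the ceiling assumes;
ForwardSourceSmoothing (same S) gives ViscousGlobal at every ν = κ/√2; then
`hasGlobal_of_viscousGlobal`, `hasGlobal_mono`, `noGlobalCascade_iff_kappa`. why it might fail: low
formal risk — matching the ceiling's hypotheses (honest solution on [0,s], non-negativity from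
OrthantInvariance on each sub-window) to the smoothing hypothesis quantified over all s ∈ (0,T].
sources: tree:Theorems/SubOnsagerCeilingBreakOfCeiling.lean; tree:Literature.Analysis.Flu -/
@[route_item "route-NavierStokesRegularity-SubOnsagerCeiling", crux]
def KPBreakOfCeiling : Prop :=
  ForwardTailCeilingKP → OrthantInvariance → ForwardSourceSmoothing → ∀ R : ℝ, 1 ≤ R → ∀ ε₀ : ℝ, 0 < ε₀ → ε₀ ≤ 1 → ∀ (α : Fin 4 → Fin 4 → Fin 4 → ℤ × ℤ × ℤ → ℝ) (X₀ : Fin 4 → ℝ), Literature.Analysis.FluidPDE.TaoCascade.InTableClass R α → (∀ (Y : Fin 4 → ℤ → ℝ → ℝ) (τ : ℝ), (∀ (j : Fin 4) (k : ℤ), 1 ≤ k → 0 ≤ Y j k τ) → ∀ δ : ℝ, 0 < δ → ∀ (i : Fin 4) (n : ℤ), 1 ≤ n → Y i n τ = 0 → 0 ≤ Literature.Analysis.FluidPDE.TaoCascade.quadTerm δ α Y i n τ) → (∀ a b i : Fin 4, a ≠ b → α a b i (0, 0, 1) = 0) → ¬ Literature.Analysis.FluidPDE.TaoCascade.NoGlobalCascade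 ε₀ α X₀

-- `KPBreakOfCeiling` holds: proved by `Summit.NavierStokesRegularity.NavierStokesRegularity.Theorems.subOnsagerCeiling_kpBreakOfCeiling_proof` (its module imports this route file, so no `_holds` link can be stated here).

/-- item stmt-NavierStokesRegularity-26609 · aside · rank 4 · closed · proved by Summit.NavierStokesRegularity.NavierStokesRegularity.Theorems.subOnsagerCeiling_forwardBreakOfCeiling_proof (prover) · by planner
why it might fail: Low formal risk but real work: η := 2θ − 1; the ceiling's hypotheses (honest solution on [0,s], non-negativity from OrthantInvariance on each sub-window) must be matched to the smoothing hypothesis quantified over all s ∈ (0,T], with C·E₀ uniform in ν and the window.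
sources: tree:Theorems/SubOnsagerCeilingBreakOfCeiling.lean, tree:Literature.Analysis.FluidPDE.Tao2016AveragedNS.ViscousEnvelopeSmoothing, BarbatoMorandinRomito2011
[crux] GLUE WITH CONTENT (rank 4; replaces BreakOfCeiling stmt-25509, proved for the total-energy
ceiling and now outside the cone): ForwardTailCeiling → OrthantInvariance → ForwardSourceSmoothing →
the ORTHANT conjunct of the rung target for every ε₀ ∈ (0,1]: ∀ R ≥ 1 ∀ ε₀ ≤ 1 ∀ orthant α ∈ E₂(R) ∀
X₀, ¬NoGlobalCascade ε₀ α X₀. Proof plan = the landed `subOnsagerCeiling_breakOfCeiling_proof` with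
T⁺ for T: the ceiling with θ > 1/2 is a window-wise subcritical envelope of the S-mode partial tails
with η = 2θ − 1 > 0 and constant C·E₀ uniform in ν and in the window; OrthantInvariance supplies the
non-negativity the ceiling assumes; ForwardSourceSmoothing (same S) gives ViscousGlobal at every ν =
κ/√2; then `hasGlobal_of_viscousGlobal`, `hasGlobal_mono`, `noGlobalCascade_iff_kappa`. why it might
fail: low formal risk — matching the ceiling's hypotheses (honest solution on [0,s], non-negativity
from OrthantInvariance on each sub-window) to the smoothing hypothesis quantified over all s ∈
(0,T]. sources: tree:Theorems/SubOnsagerCeilingBreakOfCeiling.lean;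
tree:Literature.Analysis.FluidPDE.Tao2016AveragedNS.ViscousEnvelopeSmoothing;
BarbatoMorandinRomito2011. MODEL lattice only. -/
@[route_item "route-NavierStokesRegularity-SubOnsagerCeiling"]
def ForwardBreakOfCeiling : Prop :=
  ForwardTailCeiling → OrthantInvariance → ForwardSourceSmoothing → ∀ R : ℝ, 1 ≤ R → ∀ ε₀ : ℝ, 0 < ε₀ → ε₀ ≤ 1 → ∀ (α : Fin 4 → Fin 4 → Fin 4 → ℤ × ℤ × ℤ → ℝ) (X₀ : Fin 4 → ℝ), Literature.Analysis.FluidPDE.TaoCascade.InTableClass R α → (∀ (Y : Fin 4 → ℤ → ℝ → ℝ) (τ : ℝ), (∀ (j : Fin 4) (k : ℤ), 1 ≤ k → 0 ≤ Y j k τ) → ∀ δ : ℝ, 0 < δ → ∀ (i : Fin 4) (n : ℤ), 1 ≤ n → Y i n τ = 0 → 0 ≤ Literature.Analysis.FluidPDE.TaoCascade.quadTerm δ α Y i n τ) → ¬ Literature.Analysis.FluidPDE.TaoCascade.NoGlobalCascade ε₀ α X₀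

-- `ForwardBreakOfCeiling` holds: proved by `Summit.NavierStokesRegularity.NavierStokesRegularity.Theorems.subOnsagerCeiling_forwardBreakOfCeiling_proof` (its module imports this route file, so no `_holds` link can be stated here).

/-- item stmt-NavierStokesRegularity-25509 · aside · rank 9 · closed · proved by Summit.NavierStokesRegularity.NavierStokesRegularity.Theorems.subOnsagerCeiling_breakOfCeiling_proof (prover) · by planner
sources: tree:Literature.Analysis.FluidPDE.Tao2016AveragedNS.ViscousEnvelopeSmoothing, tree:Summit.NavierStokesRegularity.NavierStokesRegularity.Theorems.orthantBreakOfWake_proof, arXiv:1402.0290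
[support] (glue with content, provable now) a θ > 1/2 tail ceiling plus cone invariance give, for
every R ≥ 1, every ε₀ ∈ (0,1] and every orthant table in E₂(R), the negation of NoGlobalCascade: set
η := 2θ − 1 > 0 and feed C·E₀·(1+ε₀)^(−(1+η)n) as the subcritical envelope into
`exists_viscousGlobal_of_subcriticalEnvelope_of_inTableClass`, then `noGlobalCascade_iff_kappa`,
`hasGlobal_of_viscousGlobal`, `hasGlobal_mono` (the proof of `orthantBreakOfWake_proof` minus its
ratchet-to-envelope lemma). [difficulty: provable-now] -/
@[route_item "route-NavierStokesRegularity-SubOnsagerCeiling"]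
def BreakOfCeiling : Prop :=
  OrthantTailCeiling → OrthantInvariance → ∀ R : ℝ, 1 ≤ R → ∀ ε₀ : ℝ, 0 < ε₀ → ε₀ ≤ 1 → ∀ (α : Fin 4 → Fin 4 → Fin 4 → ℤ × ℤ × ℤ → ℝ) (X₀ : Fin 4 → ℝ), Literature.Analysis.FluidPDE.TaoCascade.InTableClass R α → (∀ (Y : Fin 4 → ℤ → ℝ → ℝ) (τ : ℝ), (∀ (j : Fin 4) (k : ℤ), 1 ≤ k → 0 ≤ Y j k τ) → ∀ δ : ℝ, 0 < δ → ∀ (i : Fin 4) (n : ℤ), 1 ≤ n → Y i n τ = 0 → 0 ≤ Literature.Analysis.FluidPDE.TaoCascade.quadTerm δ α Y i n τ) → ¬ Literature.Analysis.FluidPDE.TaoCascade.NoGlobalCascade ε₀ α X₀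

-- `BreakOfCeiling` holds: proved by `Summit.NavierStokesRegularity.NavierStokesRegularity.Theorems.subOnsagerCeiling_breakOfCeiling_proof` (its module imports this route file, so no `_holds` link can be stated here).

/-- item stmt-NavierStokesRegularity-25511 · aside · rank 9 · open · by planner
why it might fail: the dyadic front's weighted exponent W(b) could dip to 1 at some intermediate ratio b ∈ (1,2) (g3 data: W ≥ 1.23, minimum near b = 9/8); BM13's bound is sharp in t, not in n.
sources: arXiv:1201.2693, arXiv:1310.7612, arXiv:1007.3401, arXiv:1506.07480
[aside] (banked context, never staffed) the one-mode member of the crux with no table/orthant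
hypotheses: for every scale ratio 1+ε₀ ∈ (1,2] a sub-Onsager (θ > 1/2) weighted tail ceiling for
non-negative honest viscous solutions of the scalar dyadic (KP/Desnyansky–Novikov) lattice
`dyadicTable`; BMR/CZ give it at ratio 2 only (Barbato–Morandin's any-β exponent (5/6)(1−1/β) is ≤
1/2 for every ratio ≤ 2); it is where the BC5 first rung (ratio 3/2, certified polytope) lives and
it bears on OrthantWake's aside DyadicBreakBelowOne. -/
@[route_item "route-NavierStokesRegularity-SubOnsagerCeiling"]
def DyadicTailCeiling : Prop :=
  ∀ ε₀ : ℝ, 0 < ε₀ → ε₀ ≤ 1 → ∃ θ : ℝ, 1 / 2 < θ ∧ ∃ C : ℝ, 0 ≤ C ∧ ∀ ν : ℝ, 0 < ν → ∀ (X₀ : Fin 4 → ℝ) (s : ℝ), 0 < s → ∀ X : Fin 4 → ℤ → ℝ → ℝ, (∀ (i : Fin 4) (k : ℤ), X i k 0 = if k = 0 then X₀ i else 0) → (∀ (i : Fin 4) (k : ℤ), k < 0 → ∀ t : ℝ, X i k t = 0) → (∃ M : ℝ, ∀ (t : ℝ) (i : Fin 4) (k : ℤ), (1 + (1 + ε₀)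 ^ ((10 : ℝ) * k)) * |X i k t| ≤ M) → (∀ (i : Fin 4) (k : ℤ), Continuous (X i k)) → (∀ (i : Fin 4) (k : ℤ), ∀ t ∈ Set.Icc (0 : ℝ) s, HasDerivWithinAt (X i k) (Literature.Analysis.FluidPDE.TaoCascade.quadTerm ε₀ Literature.Analysis.FluidPDE.TaoCascade.dyadicTable X i k t - ν * (1 + ε₀) ^ ((2 : ℝ) * k) * X i k t) (Set.Icc (0 : ℝ) s) t) → (∀ t ∈ Set.Icc (0 : ℝ) s, ∀ (i : Fin 4) (k : ℤ), 1 ≤ k → 0 ≤ X i k t) → ∀ n N : ℕ, n ≤ N → ∀ t ∈ Set.Icc (0 : ℝ) s, ∑ k ∈ Finset.Icc n N, ∑ i : Fin 4, (1 / 2 : ℝ) * X i (k : ℤ) t ^ 2 ≤ C * (∑ i : Fin 4, (1 / 2 : ℝ) * X₀ i ^ 2) * (1 + ε₀) ^ (-(2 * θ * (n : ℝ)))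

/-- item stmt-NavierStokesRegularity-25510 · assembly · rank 1 · closed · proved by Summit.NavierStokesRegularity.NavierStokesRegularity.Theorems.subOnsagerCeiling_assembly_proof (prover) · by planner
sources: arXiv:1402.0290
[assembly] OrthantTailCeiling → OrthantInvariance → BreakOfCeiling → NonOrthantBreak → rung target
TL-M2Break. -/
@[route_item "route-NavierStokesRegularity-SubOnsagerCeiling"]
def Assembly : Prop :=
  OrthantTailCeiling → OrthantInvariance → BreakOfCeiling → NonOrthantBreak → Summit.NavierStokesRegularity.NavierStokesRegularity.Theses.TaoLadderRungTwoBreak.Target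

-- `Assembly` holds: proved by `Summit.NavierStokesRegularity.NavierStokesRegularity.Theorems.subOnsagerCeiling_assembly_proof` (its module imports this route file, so no `_holds` link can be stated here).

/-! D-0027 §2.1 — DECIDING THEOREM (planner-authored via `route open/edit --closes-file`; by planner-ns-idea-1-g5-0 2026-08-28T08:56:59Z):
its hypotheses are this route's items and its conclusion the registered leaf `Summit.NavierStokesRegularity.NavierStokesRegularity.Theses.TaoLadderRungTwoBreak.Target` (rung TL-M2Break, D-0061) (glue_lint), and it elaborates with this file. -/

@[closes "route-NavierStokesRegularity-SubOnsagerCeiling"] theorem closes (h1 : ForwardTailCeilingKP) (h2 : OrthantInvariance) (hB : ForwardSourceSmoothing)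
    (h3 : KPBreakOfCeiling) (h5 : NonDiagonalOrthantBreak) (h4 : NonOrthantBreak) :
    Summit.NavierStokesRegularity.NavierStokesRegularity.Theses.TaoLadderRungTwoBreak.Target := by
  intro R hR
  obtain ⟨ε₃, hε₃, H3⟩ := h5 R hR
  obtain ⟨ε₂, hε₂, H2⟩ := h4 R hR
  refine ⟨min 1 (min ε₃ ε₂), lt_min one_pos (lt_min hε₃ hε₂), ?_⟩
  intro ε₀ h0 hle α X₀ hα
  by_cases hO : (∀ (Y : Fin 4 → ℤ → ℝ → ℝ) (τ : ℝ), (∀ (j : Fin 4) (k : ℤ), 1 ≤ k → 0 ≤ Y j k τ) → ∀ δ : ℝ, 0 < δ → ∀ (i : Fin 4) (n : ℤ), 1 ≤ n → Y i n τ = 0 → 0 ≤ Literature.Analysis.FluidPDE.TaoCascade.quadTerm δ α Y i n τ)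
  · by_cases hD : (∀ a b i : Fin 4, a ≠ b → α a b i (0, 0, 1) = 0)
    · exact h3 h1 h2 hB R hR ε₀ h0 (hle.trans (min_le_left _ _)) α X₀ hα hO hD
    · exact H3 ε₀ h0 ((hle.trans (min_le_right _ _)).trans (min_le_left _ _)) α X₀ hα hO hD
  · exact H2 ε₀ h0 ((hle.trans (min_le_right _ _)).trans (min_le_right _ _)) α X₀ hα hO

end Summit.NavierStokesRegularity.NavierStokesRegularity.Theses.SubOnsagerCeiling
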